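import Mathlib
import Literature.MathematicalPhysics.QuantumLattice.GrassmannKernels

/-!
# Weak (functional-wise) product and power rules for curves in the Grassmann algebra

Support for Polchinski's equation / the seed flow of crux stmt-14047 (line polchinski-seed-flow):
the finite-dimensional Grassmann algebra `GrassmannAlgebra ℂ Γ` carries no norm, so a curve
`s ↦ X s` is differentiated through every `ℂ`-linear functional `φ`.  Expanding one factor in the
monomial basis `grassmannBasis` reduces the product rule for `s ↦ φ (X s * Y s)` to the scalar
product rule for finitely many coordinate functions; the power rule follows by induction for a
curve commuting with its derivative.
-/

set_option linter.dupNamespace false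

namespace Summit.HubbardSuperconductivity.HubbardSuperconductivity.Theorems.AposterioriCapRgSeededBrokenRegimeBoseFermiPinned

open Literature.MathematicalPhysics.QuantumLattice GrassmannAlgebra

/-- Expansion of a functional of a product along a finite basis in the first factor:
`φ (x * y) = Σ_a x_a · φ (b_a * y)`. [folklore] -/
theorem apply_mul_eq_sum_coord_mul_apply {ι A : Type*} [Fintype ι] [Ring A] [Algebra ℂ A]
    (b : Module.Basis ι ℂ A) (φ : A →ₗ[ℂ] ℂ) (x y : A) :
    φ (x * y) = ∑ a, b.coord a x * φ (b a * y) := by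
  conv_lhs => rw [← b.sum_repr x]
  rw [Finset.sum_mul, map_sum]
  refine Finset.sum_congr rfl fun a _ => ?_
  rw [smul_mul_assoc, map_smul, smul_eq_mul, Module.Basis.coord_apply]

/-- **Weak product rule along a finite basis**: if the curves `X`, `Y` in a `ℂ`-algebra with a
finite basis are differentiable at `t` through every linear functional, with weak derivatives
`X'`, `Y'`, then so is `s ↦ X s * Y s`, with weak derivative `X' * Y t + X t * Y'`. [folklore] -/
theorem hasDerivAt_apply_mul_of_basis {ι A : Type*} [Fintype ι] [Ring A] [Algebra ℂ A]
    (b : Module.Basis ι ℂ A) (X Y : ℝ → A) (X' Y' : A) (t : ℝ)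
    (hX : ∀ φ : A →ₗ[ℂ] ℂ, HasDerivAt (fun s => φ (X s)) (φ X') t)
    (hY : ∀ φ : A →ₗ[ℂ] ℂ, HasDerivAt (fun s => φ (Y s)) (φ Y') t) (φ : A →ₗ[ℂ] ℂ) :
    HasDerivAt (fun s => φ (X s * Y s)) (φ (X' * Y t + X t * Y')) t := by
  have h1 : ∀ a, HasDerivAt (fun s => b.coord a (X s)) (b.coord a X') t := fun a => hX (b.coord a)
  have h2 : ∀ a, HasDerivAt (fun s => φ (b a * Y s)) (φ (b a * Y')) t := fun a =>
    hY (φ ∘ₗ LinearMap.mulLeft ℂ (b a))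
  have hfun : (fun s => φ (X s * Y s)) = fun s => ∑ a, b.coord a (X s) * φ (b a * Y s) :=
    funext fun s => apply_mul_eq_sum_coord_mul_apply b φ (X s) (Y s)
  have hderiv : ∑ a, (b.coord a X' * φ (b a * Y t) + b.coord a (X t) * φ (b a * Y')) =
      φ (X' * Y t + X t * Y') := by
    rw [Finset.sum_add_distrib, map_add, ← apply_mul_eq_sum_coord_mul_apply,
      ← apply_mul_eq_sum_coord_mul_apply]
  rw [hfun]
  exact (HasDerivAt.fun_sum fun a _ => (h1 a).fun_mul (h2 a)).congr_deriv hderiv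

/-- **Weak product rule in the Grassmann algebra**: if the curves `X`, `Y` in the Grassmann
algebra on a finite label set are differentiable at `t` through every `ℂ`-linear functional,
with weak derivatives `X'`, `Y'`, then `s ↦ φ (X s * Y s)` is differentiable at `t` with
derivative `φ (X' * Y t + X t * Y')` for every linear functional `φ` (expansion in the finite
monomial basis and the scalar product rule). [folklore] -/
theorem hasDerivAt_apply_mul :
    ∀ {Γ : Type} [Fintype Γ] [DecidableEq Γ] (X Y : ℝ → GrassmannAlgebra ℂ Γ) (X' Y' : GrassmannAlgebra ℂ Γ) (t : ℝ),
      (∀ φ : GrassmannAlgebra ℂ Γ →ₗ[ℂ] ℂ, HasDerivAt (fun s => φ (X s)) (φ X') t) →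
      (∀ φ : GrassmannAlgebra ℂ Γ →ₗ[ℂ] ℂ, HasDerivAt (fun s => φ (Y s)) (φ Y') t) →
        ∀ φ : GrassmannAlgebra ℂ Γ →ₗ[ℂ] ℂ, HasDerivAt (fun s => φ (X s * Y s)) (φ (X' * Y t + X t * Y')) t := by
  intro Γ _ _ X Y X' Y' t hX hY φ
  letI : LinearOrder Γ := LinearOrder.lift' (Fintype.equivFin Γ) (Fintype.equivFin Γ).injective
  exact hasDerivAt_apply_mul_of_basis (grassmannBasis ℂ Γ) X Y X' Y' t hX hY φ

/-- **Weak power rule in the Grassmann algebra** for a curve commuting with its weak derivative at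
`t`: `∂_s φ (X s ^ (n+1)) = φ ((n+1) · X t ^ n · X')` for every `ℂ`-linear functional `φ`
(induction on `n` from the weak product rule; `Commute (X t) X'` moves `X'` to the right).
[folklore] -/
theorem hasDerivAt_apply_pow_of_commute :
    ∀ {Γ : Type} [Fintype Γ] [DecidableEq Γ] (X : ℝ → GrassmannAlgebra ℂ Γ) (X' : GrassmannAlgebra ℂ Γ) (t : ℝ),
      (∀ φ : GrassmannAlgebra ℂ Γ →ₗ[ℂ] ℂ, HasDerivAt (fun s => φ (X s)) (φ X') t) → Commute (X t) X' →
        ∀ (n : ℕ) (φ : GrassmannAlgebra ℂ Γ →ₗ[ℂ] ℂ),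
          HasDerivAt (fun s => φ (X s ^ (n + 1))) (φ (((n + 1 : ℕ) : ℂ) • (X t ^ n * X'))) t := by
  intro Γ _ _ X X' t hX hc n
  induction n with
  | zero =>
    intro φ
    simp only [zero_add, pow_one, pow_zero, one_mul, Nat.cast_one, one_smul]
    exact hX φ
  | succ n ih =>
    intro φ
    have hfun : (fun s => φ (X s ^ (n + 1 + 1))) = fun s => φ (X s * X s ^ (n + 1)) := by
      funext s
      rw [pow_succ' (X s) (n + 1)]
    have key : HasDerivAt (fun s => φ (X s * X s ^ (n + 1)))
        (φ (X' * X t ^ (n + 1) + X t * ((n + 1 : ℕ) : ℂ) • (X t ^ n * X'))) t :=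
      hasDerivAt_apply_mul X (fun s => X s ^ (n + 1)) X' (((n + 1 : ℕ) : ℂ) • (X t ^ n * X')) t hX ih φ
    rw [hfun]
    refine key.congr_deriv (congrArg φ ?_)
    rw [← (hc.pow_left (n + 1)).eq, mul_smul_comm, ← mul_assoc, ← pow_succ', Nat.cast_succ (n + 1),
      add_smul, one_smul, add_comm]

end Summit.HubbardSuperconductivity.HubbardSuperconductivity.Theorems.AposterioriCapRgSeededBrokenRegimeBoseFermiPinned
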